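import Summits.ValiantsHypothesis.ValiantsHypothesis.Theses.BorderApolarity
import Summits.ValiantsHypothesis.ValiantsHypothesis.Theorems.BorderApolarityFixedWitnessObstructionQPConePurity
import Summits.ValiantsHypothesis.ValiantsHypothesis.Theorems.BorderApolarityFixedWitnessObstructionQPH0Elementary
import Summits.ValiantsHypothesis.ValiantsHypothesis.Theorems.BorderApolarityFixedWitnessObstructionQPAnnSubmodule
import Summits.ValiantsHypothesis.ValiantsHypothesis.Theorems.BorderApolarityFixedWitnessObstructionQPKuratowskiSubmodule
import Summits.ValiantsHypothesis.ValiantsHypothesis.Theorems.BorderApolarityFixedWitnessObstructionQPLimitIdeal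
import Literature.Computability.AlgebraicComplexity.Apolarity
import HarnessLib.Audit

/-!
# Line `cone-purity-squeeze` — skeleton for crux `BorderApolarity.FixedWitnessObstructionQP`
(item stmt-ValiantsHypothesis-5778, route route-ValiantsHypothesis-BorderApolarity)

Idea (card `Cruxes/FixedWitnessObstructionQP/Ideas/cone-purity-squeeze.md`, merged with
`padding-rung-budget` per triage r1-1/r1-2/r1-3): the unipotent radical of `H₀(n,m)` ("lower every own
variable `ℓ, Y` into the unused variables `z`") together with ONE number contributed by the determinant —
the Hilbert function value `dim Ann_k(det_m) = C(m²+k-1,k) - C(m,k)²` — forces every `H₀`-fixed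
border-apolar limit `J` to contain NO nonzero `z`-free operator in every degree `k` where the budget
inequality `C(m²+k-1,k) < C(m²-n²-2+k,k) + C(m,k)²` holds (CONE PURITY: `J_k ⊆ (∂_z)`, dually
`V_k := J_k^⊥ ⊇ S^k⟨ℓ,Y⟩`).  Below that degree `k*(m/n)` the apolarity clause W5 is vacuous; all
per-versus-det content of a fixed witness sits in the `z`-free permutation-weight components of degree
`≥ k*`, ultimately in the single top hyperplane `J_m = Ann_m(ℓ^{m-n} per_n)` (the UNSIGNED hyperplane of the
permutation-monomial space, versus the SIGNED one of the padded determinant `ℓ^{m-n} det_n`, whose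
`H₀`-fixed witnesses exist for every `m ≥ n` — triage control (A)/(F1)).

Skeleton.  Five infrastructure stubs turn a witness `(P, J)` of the crux (clauses W1–W5) into its PURE
NORMAL FORM — each `J k` (`k ≤ m`) is a subspace of degree-`k` operators with the determinant's Hilbert
function (`stub_annSubmodule` = W1's content, `stub_kuratowskiSubmodule` = W2 ∧ W3's content), the family is
an ideal truncation (`stub_limitIdeal`), the two one-parameter families `∂_y ↦ ∂_y + c ∂_z`, `∂_z ↦ d ∂_z`
lie in `H₀(n,m)` (`stub_h0Elementary` = the part of W4 purity consumes), and CONE PURITY itself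
(`stub_conePurity`, the card's first lemma, abstract linear algebra) — and the sixth stub
`stub_pureBorderObstruction` is the crux RESTRICTED TO PURE NORMAL-FORM WITNESSES (the "climb"; it keeps
W1–W3 verbatim: see the line card, § "Why the border clauses stay" — the abstract version without them is
FALSE for `m ≥ n³` in every checked instance, already at `m = 4n²` for `n ≤ 8`; witness: lex-segment bottom ⊕
free `z`-free top).  `FixedWitnessObstructionQP_of` composes them (sorry-free): given `c`, take the climb's
`n₀`; a crux witness in the window is upgraded to a pure normal-form witness by the five lemmas, contradiction.

Disproof.lean (cdisprove gen 2) obligations honoured: `false_without_limsup` — W3 is used at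
`stub_kuratowskiSubmodule` (the dimension lower bound of a Kuratowski limit needs (Ls); the junk family
`J ≡ {0}` violates normal form N1) and kept in the climb; `false_without_orbit` — W1 is used at
`stub_annSubmodule` (the fat point `x^{(m,…,m)}` has `Ann_{≤ m} = 0`, violating N1) and kept in the climb;
`not_crux_expWindow` / `crux_threshold_two/three` — only the climb quantifies over `(n,m)` and it keeps the
exact quasi-polynomial window and the `∀ c ∃ n₀` shape (no stub asserts anything for `m ≥ 2ⁿ - 1`, where
Grenet witnesses exist; `n₀(2) ≥ 65` is untouched); `crux_iff_gctWindow` / `crux_of_gctThesis` —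
acknowledged: given the five lemmas the climb is equivalent to X, i.e. to the qp Mulmuley–Sohoni window; the
line's claim is exposure (pure normal form; per-content = one hyperplane position above a rigid bottom), not a
weakening.  §6 computations (`FixedWitnessComputations.md`): purity confirmed on the computed `H₀`-fixed
witnesses ((3,7) per/det: `V₂ ⊇ S²U`, `V₃ ⊇ S³U`; (2,4): `V₂ ⊇ S²U`), and all per-specific content of the
(3,7) witness sits in `z`-free components of degrees 4–7 — the picture the climb formalises.  Negatives index
(stmt-5668/0340/3735/3738): no stub is an instance.

`lean check`: rc 0, sorries only in the six `stub_*`; `FixedWitnessObstructionQP_of` concludes the crux BY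
NAME (audit: proof-of-item, not closed — sorryAx via the stubs).  Stub signatures use only importable
declarations (`Literature.Computability.AlgebraicComplexity.{linSubst, glOrbit, detPoly, paddedPerPoly,
coeffVec, apolarAction, annihilatorOfDegree, IsBorderApolarLimit}`, Mathlib), so each can be landed verbatim
as `Theorems/BorderApolarityFixedWitnessObstructionQP<Stub>.lean --supports stmt-ValiantsHypothesis-5778`.
-/

open MvPolynomial Filter
open scoped BigOperators Matrix
open Literature.Computability.AlgebraicComplexity
open Summit.ValiantsHypothesis.ValiantsHypothesis.Theses.BorderApolarity
open Summit.ValiantsHypothesis.ValiantsHypothesis.Theorems.BorderApolarityFixedWitnessObstructionQP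

set_option linter.dupNamespace false

namespace Summit.ValiantsHypothesis.ValiantsHypothesis.Cruxes.FixedWitnessObstructionQP.ConePuritySqueeze

/-! ## Stubs -/

/-! Stubs 1–5 are LANDED (wave 1, 2026-08-16) as
`Summits/ValiantsHypothesis/ValiantsHypothesis/Theorems/BorderApolarityFixedWitnessObstructionQP{ConePurity,
H0Elementary,AnnSubmodule,KuratowskiSubmodule,LimitIdeal}.lean` (p73002, p72335, p72136, p72146, p71904), all
`--supports stmt-ValiantsHypothesis-5778`, namespace
`Summit.ValiantsHypothesis.ValiantsHypothesis.Theorems.BorderApolarityFixedWitnessObstructionQP` (opened below):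
`stub_conePurity`, `stub_h0Elementary`, `stub_annSubmodule`, `stub_kuratowskiSubmodule`, `stub_limitIdeal` are
now theorems and are used by name in the glue.  Only Stub 6 (the climb) remains. -/


/-- **Stub 6 — THE CLIMB (hardest; open-problem sized): no PURE normal-form witness in the quasi-polynomial
window.**  For every `c` there is `n₀` such that for `n ≥ n₀` and `n ≤ m ≤ 2^((log₂ n + c)^c)` there is no
pair `(P, J)` with: (W1) `P t ∈ GL_{m²}·det_m`; (W2 ∧ W3) `J` = degree-wise Kuratowski limit of `Ann(P t)`,
`k ≤ m` (`IsBorderApolarLimit`); (W4) `J` stable under `H₀(n,m)` (verbatim); (W5) `J k ⌟ ℓ^{m-n}per_n = 0`;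
AND the normal form the other five stubs PROVE for every such witness: (N1) each `J k` is a subspace of
degree-`k` forms of dimension `C(m²+k-1,k) - C(m,k)²`; (N2) `J k · ∂_i ⊆ J (k+1)`; (N3) CONE PURITY — in
every budget-pure degree `k` (`C(m²+k-1,k) < C(m²-n²-2+k,k) + C(m,k)²`, i.e. `k < k*(m/n) ≈ (log m)/log(m/n…)`;
`k* - 1 = 3,5,5,7` at `(n,m) = (3,17),(8,512),(16,1024),(16,4096)`) `J k` has no nonzero `z`-free element
(`J k ⊆ (∂_z)`, dually `V_k ⊇ S^k⟨ℓ,Y⟩`, W5 vacuous there).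
Equivalent to the crux given stubs 1–5 (and to `GctWindow` by `crux_iff_gctWindow`); what is exposed: the
per-content of a witness is the position of ONE hyperplane — by N2 + W5, `J m = Ann_m(ℓ^{m-n}per_n)`, i.e.
`J m ∩ Π_{n,m}` is the UNSIGNED hyperplane `{Σ_σ c_σ = 0}` of the permutation-monomial space
`Π_{n,m} = ⟨∂_ℓ^{m-n} Π_i ∂_{Y_{iσ(i)}}⟩` (the SIGNED one `{Σ sgn(σ) c_σ = 0}` IS realised for all `m ≥ n`:
padded-determinant control F1; every `H₀`-fixed point of `Z_det_m` lies over some padded permutation-sum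
`ℓ^{m-n} Σ_σ c_σ Y_σ`, F2) — to be excluded for ideals squeezed between the rigid pure bottom
`J_{<k*} ⊆ (∂_z)` with the lex-type `z`-layers and the determinant's border geometry (W1–W3 are KEPT: the
abstract statement with only N1–N3 + W4 + W5 is false for `m ≥ n³` in every checked instance, see the line card).  Why it might
fail: it is the qp Mulmuley–Sohoni thesis in normal form; bdc(per_n) ≤ 2^{polylog n} i.o. refutes it. -/
theorem stub_pureBorderObstruction :
    ∀ c : ℕ, ∃ n₀ : ℕ, ∀ n ≥ n₀, ∀ (m : ℕ) [NeZero m], n ≤ m → m ≤ 2 ^ ((Nat.log 2 n + c) ^ c) →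
      ¬ ∃ (P : ℕ → MvPolynomial (Fin m × Fin m) ℂ) (J : ℕ → Set (MvPolynomial (Fin m × Fin m) ℂ)),
        (∀ t : ℕ, P t ∈ glOrbit (Fin m × Fin m) ℂ (detPoly (Fin m) ℂ)) ∧
        IsBorderApolarLimit m P J ∧
        (∀ A : Matrix.GeneralLinearGroup (Fin m × Fin m) ℂ,
          let M : Matrix (Fin m × Fin m) (Fin m × Fin m) ℂ := A
          let rk := fun (p : Fin m × Fin m) =>
            (if (m - n ≤ (p.1 : ℕ) ∧ m - n ≤ (p.2 : ℕ)) ∨ p = (0, 0) then 0 else m * m) +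
              ((p.1 : ℕ) * m + (p.2 : ℕ))
          (∀ i j : Fin m × Fin m, M j i ≠ 0 → rk j ≤ rk i) →
          (∀ i j : Fin m × Fin m, ((m - n ≤ (i.1 : ℕ) ∧ m - n ≤ (i.2 : ℕ)) ∨ i = (0, 0)) → j ≠ i → M j i = 0) →
          (∀ i k j l : Fin m, m - n ≤ (i : ℕ) → m - n ≤ (k : ℕ) → m - n ≤ (j : ℕ) → m - n ≤ (l : ℕ) →
            M (i, j) (i, j) * M (k, l) (k, l) = M (i, l) (i, l) * M (k, j) (k, j)) →
          M (0, 0) (0, 0) ^ (m - n) * ∏ i ∈ Finset.univ.filter (fun i : Fin m => m - n ≤ (i : ℕ)), M (i, i) (i, i) = 1 →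
          ∀ k ≤ m, ∀ D ∈ J k, linSubst (Fin m × Fin m) ℂ Mᵀ D ∈ J k) ∧
        (∀ k ≤ m, ∀ D ∈ J k, apolarAction D (paddedPerPoly ℂ n m) = 0) ∧
        (∀ k ≤ m, ∃ Jk : Submodule ℂ (MvPolynomial (Fin m × Fin m) ℂ),
          (Jk : Set (MvPolynomial (Fin m × Fin m) ℂ)) = J k ∧
          Jk ≤ MvPolynomial.homogeneousSubmodule (Fin m × Fin m) ℂ k ∧
          Module.finrank ℂ Jk = Nat.choose (m * m + k - 1) k - (Nat.choose m k) ^ 2) ∧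
        (∀ k : ℕ, k + 1 ≤ m → ∀ D ∈ J k, ∀ i : Fin m × Fin m, D * MvPolynomial.X i ∈ J (k + 1)) ∧
        (∀ k ≤ m, Nat.choose (m * m + k - 1) k < Nat.choose (m * m - n * n - 2 + k) k + (Nat.choose m k) ^ 2 →
          ∀ D ∈ J k, (∀ s ∈ D.support, ∀ v : Fin m × Fin m,
            ¬ ((m - n ≤ (v.1 : ℕ) ∧ m - n ≤ (v.2 : ℕ)) ∨ v = (0, 0)) → s v = 0) → D = 0) := by
  sorry

/-! ## Glue (sorry-free) -/

/-- Normal form N1 from stubs 3 + 4: each `J k`, `k ≤ m`, is a subspace of degree-`k` forms with the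
determinant's Hilbert function. -/
theorem exists_limitSubmodule {m : ℕ} {P : ℕ → MvPolynomial (Fin m × Fin m) ℂ}
    {J : ℕ → Set (MvPolynomial (Fin m × Fin m) ℂ)}
    (hW1 : ∀ t : ℕ, P t ∈ glOrbit (Fin m × Fin m) ℂ (detPoly (Fin m) ℂ))
    (hBL : IsBorderApolarLimit m P J) {k : ℕ} (hk : k ≤ m) :
    ∃ Jk : Submodule ℂ (MvPolynomial (Fin m × Fin m) ℂ),
      (Jk : Set (MvPolynomial (Fin m × Fin m) ℂ)) = J k ∧
      Jk ≤ MvPolynomial.homogeneousSubmodule (Fin m × Fin m) ℂ k ∧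
      Module.finrank ℂ Jk = Nat.choose (m * m + k - 1) k - (Nat.choose m k) ^ 2 := by
  classical
  choose A hAcar hAle hAdim using fun t => stub_annSubmodule m k (P t) (hW1 t)
  have hmemA : ∀ {t : ℕ} {E : MvPolynomial (Fin m × Fin m) ℂ},
      E ∈ A t ↔ E ∈ annihilatorOfDegree (P t) k := fun {t E} => by
    rw [← SetLike.mem_coe, hAcar]
  refine stub_kuratowskiSubmodule k _ A (J k) hAle hAdim ?_ ?_
  · intro D hD
    obtain ⟨Ds, hDs, hlim⟩ := hBL.exists_tendsto hk hD
    exact ⟨Ds, fun t => hmemA.2 (hDs t), hlim⟩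
  · intro D φ Ds hφ hDs hlim
    exact hBL.mem_of_tendsto hk hφ (fun t => hmemA.1 (hDs t)) hlim

/-- **The composition** (concludes the crux BY NAME): given `c`, take the climb's threshold; a crux witness
`(P, J)` at `(n, m)` in the window is a pure normal-form witness by stubs 1–5, contradicting stub 6.
(`act` of the crux is `apolarAction` token for token, and its `rk` the inline weight of stubs 2 and 6, so the
clauses are passed across by definitional unfolding.) -/
theorem FixedWitnessObstructionQP_of : FixedWitnessObstructionQP := by
  classical
  intro c
  obtain ⟨n₀, hn₀⟩ := stub_pureBorderObstruction c
  refine ⟨n₀, fun n hn m _ hnm hm => ?_⟩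
  intro act rk
  rintro ⟨P, J, hW1, hLi, hLs, hW4, hW5⟩
  have hBL : IsBorderApolarLimit m P J := ⟨hLi, hLs⟩
  refine hn₀ n hn m hnm hm ⟨P, J, hW1, hBL, hW4, hW5, ?_, ?_, ?_⟩
  · -- N1: subspace + Hilbert function
    intro k hk
    exact exists_limitSubmodule hW1 hBL hk
  · -- N2: ideal truncation
    exact stub_limitIdeal m P J hBL
  · -- N3: cone purity
    intro k hk hbudget D hD hzfree
    obtain ⟨Jk, hcar, hle, hdim⟩ := exists_limitSubmodule hW1 hBL hk
    have hmem : ∀ {E : MvPolynomial (Fin m × Fin m) ℂ}, E ∈ Jk ↔ E ∈ J k := fun {E} => by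
      rw [← SetLike.mem_coe, hcar]
    obtain ⟨hzif, htor⟩ := stub_h0Elementary n m J hW4 k hk
    refine stub_conePurity n m k Jk (fun E hE => ?_) (fun y z hy hz c' E hE => ?_)
      (fun z hz d hd E hE => ?_) hdim hbudget D (hmem.2 hD) hzfree
    · exact (MvPolynomial.mem_homogeneousSubmodule k E).1 (hle hE)
    · exact hmem.2 (hzif y z hy hz c' E (hmem.1 hE))
    · exact hmem.2 (htor z hz d hd E (hmem.1 hE))

end Summit.ValiantsHypothesis.ValiantsHypothesis.Cruxes.FixedWitnessObstructionQP.ConePuritySqueeze
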